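import Summits.HodgeConjecture.HodgeConjecture.Theorems.PadicSemiregularLiftFormalLiftingFromClassLiftingHuTowerAlgebra
import Literature.AlgebraicGeometry.KTheory.HuInfinitesimalKZero

/-!
# `FormalLiftingFromClassLifting` (stmt-HodgeConjecture-13825) · line `hu` · the crux from X. Hu's two named facts and the two coherent lattice lemmas

Crux P1a of route `PadicSemiregularLift` follows, through the landed glue
(`Glue.liftsFormally_of_stepClassLifting`, `Glue.stepClassLifting_of_levelwiseLifts_of_kernelTower`)
and the landed `K₀`-tower algebra of line `hu` (`HuLine.kernelTower_of_naturalSurjections`,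
`HuLine.levelwiseLift_of_obstructionData`), from FOUR inputs, and this file performs exactly that
instantiation, sorry-free, so that the remaining obligations of the line are the two COHERENT
LATTICE LEMMAS, stated here verbatim in the form the tower algebra consumes them:

* X. Hu's two NAMED FACTS over the tree's carriers (`Literature/AlgebraicGeometry/KTheory/
  HuInfinitesimalKZero`, arXiv:2507.12458): `KTheory.HuKZeroKernelPresentation` (Cor. 10.5 (i),
  `i = 0`: `ρ m n : ⊕_{r=1}^{p-1} ℍ^{2r-1}(p^{r,m}_{r,n}Ω•) → K₀(X_n)` onto
  `ker(K₀(X_n) → K₀(X_m))`, natural in `n`) and `KTheory.HuKZeroLiftingCriterion` (Thm. 1.2 =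
  Prop. 11.1 (i): `ob m n : K₀(X_m) → ⊕_{r=1}^{d-1} ℍ^{2r}(p^{r,m}_{r,n}Ω•)` with
  `ker (ob m n) = im(K₀(X_n) → K₀(X_m))`, compatible in `n`), both used at `m = 1`;
* (L1) `HuKernelTransitionsSurjective p k d 𝒳` — the transitions
  `⊕_r ℍ^{2r-1}(p^{r,1}_{r,N+3}Ω•) → ⊕_r ℍ^{2r-1}(p^{r,1}_{r,N+2}Ω•)`
  (`KTheory.HuKernelSource.reduce 1 (Nat.le_succ (N + 2))`) are onto for every `N`;
* (L2) `HuObstructionTowerTorsionFree p k d 𝒳` — on the tower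
  `N ↦ ⊕_{r=1}^{d-1} ℍ^{2r}(p^{r,1}_{r,N+2}Ω•)` with the reductions
  `KTheory.HuObstructionTarget.reduce d 1 (Nat.le_succ (N + 2))`, every compatible family killed by
  a non-zero integer vanishes.

(L1) and (L2) are spelled out INLINE in the signatures below (no definitions in this file). On
paper both hold under the hypotheses of the crux (torsion-free `Hᵇ(𝒳, 𝒪)`, `Hᵇ(𝒳, Ω¹)`,
`d ≤ 3 ∨ Ω¹` free, `d + 6 < p`) by the degeneration of the Hodge–de Rham spectral sequence modulo
torsion transferred to the staircase complexes (Bloch–Esnault–Kerz, Invent. Math. 195 (2014),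
Rem. 8.x; X. Hu, arXiv:2507.12458, §11); they are the objects of the line's Literature files
(`Algebra/Homology/StupidFiltrationDegeneration`, `StaircaseRetraction`, `InverseSystemExtensions`,
`ExtModPowers`, …) and are NOT proved here.

Results:

* `kernelTower_of_huKernelPresentation` — `HuKZeroKernelPresentation` + (L1) ⇒ the registered stub
  `stub_kernelTower` ((2_K) kernel-tower surjectivity), for `𝒳` smooth proper of relative dimension
  `d` with `d + 5 ≤ p`;
* `levelwiseClassLift_of_huLiftingCriterion` — `HuKZeroLiftingCriterion` + (L2) ⇒ the registered
  stub `stub_levelwiseClassLift` (level-wise (1_K)) for every finite locally free `E₁` with a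
  rational pro-class lift, `d + 6 ≤ p`;
* `formalLiftingFromClassLifting_of_huFacts` — the crux `FormalLiftingFromClassLifting` BY NAME from
  the two named facts and the two lattice lemmas (each lattice lemma quantified over the crux's
  data and hypotheses, verbatim).

The conclusion is CONDITIONAL on the two named facts (claims of an unrefereed preprint, see the
caveats (α)–(ζ) of `KTheory/HuInfinitesimalKZero`); nothing in this file uses smoothness,
properness or the bound on `p` except to invoke them.
-/

set_option linter.dupNamespace false

namespace Summit.HodgeConjecture.HodgeConjecture.Theorems.FormalLiftingFromClassLifting.HuLine

open CategoryTheory AlgebraicGeometry Limits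
open Literature.AlgebraicGeometry Literature.AlgebraicGeometry.Motives
open Literature.AlgebraicGeometry.Motives.WittScheme
open Literature.AlgebraicGeometry.KTheory
open Summit.HodgeConjecture.HodgeConjecture.Theses.PadicSemiregularLift
open Summit.HodgeConjecture.HodgeConjecture.Theorems.FormalLiftingFromClassLifting
open Summit.HodgeConjecture.HodgeConjecture.Theorems.FormalLiftingFromClassLifting.Negative
  (exists_int_multiple_lifts_all_levels)

noncomputable section

/-! ## (2_K) from Hu's kernel presentation and (L1) -/

/-- **Kernel tower from Hu's kernel presentation + surjective transitions (L1).** For `k` perfect of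
characteristic `p` and `𝒳/W(k)` a smooth proper model of relative dimension `d` with `d + 5 ≤ p`,
X. Hu's presentation `ρ 1 n : ⊕_{r=1}^{p-1} ℍ^{2r-1}(p^{r,1}_{r,n}Ω•) ↠ ker(K₀(X_n) → K₀(X_1))`
(`KTheory.HuKZeroKernelPresentation`, natural in `n`) together with the surjectivity of the
transitions `KTheory.HuKernelSource.reduce 1 (N+2 ≤ N+3)` (the coherent lattice lemma (L1),
hypothesis `hL1`) give kernel-tower surjectivity: every class on `X_{n+1}` dying on `X_k` is the
restriction of a class on `X_{n+2}` dying on `X_k` — verbatim the conclusion of the registered stub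
`stub_kernelTower`, by `kernelTower_of_naturalSurjections`. [folklore] -/
theorem kernelTower_of_huKernelPresentation (hHu : HuKZeroKernelPresentation)
    {p : ℕ} [Fact p.Prime] {k : Type} [Field k] [CharP k p] [PerfectRing k p] {d : ℕ}
    (𝒳 : SchemeOver (WittVector p k)) (h𝒳 : IsSmoothProperModel d 𝒳) (hp : d + 5 ≤ p)
    (hL1 : ∀ N : ℕ, Function.Surjective
      (HuKernelSource.reduce (p := p) (k := k) (𝒳 := 𝒳) 1 (Nat.le_succ (N + 2)))) :
    ∀ (n : ℕ) (t : KZero (thickening 𝒳 (n + 1)).left),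
      KZero.map (specialFibreToThickening 𝒳 n) t = 0 →
      ∃ t' : KZero (thickening 𝒳 (n + 2)).left,
        KZero.map (specialFibreToThickening 𝒳 (n + 1)) t' = 0 ∧
        KZero.map (thickeningMap 𝒳 (Nat.le_succ (n + 1))) t' = t := by
  obtain ⟨ρ, hρa, hρb⟩ := hHu p k d 𝒳 h𝒳 hp
  refine kernelTower_of_naturalSurjections p k 𝒳 (fun N => HuKernelSource p k 𝒳 1 (N + 2))
    (fun N => ρ 1 (N + 2)) (fun N => HuKernelSource.reduce 1 (Nat.le_succ (N + 2)))
    (fun N s => ?_) (fun N t ht => ?_) (fun N s => ?_) hL1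
  · exact (hρa 1 (N + 2) (by omega) le_rfl (ρ 1 (N + 2) s)).2 ⟨s, rfl⟩
  · exact (hρa 1 (N + 2) (by omega) le_rfl t).1 ht
  · exact hρb 1 (N + 2) (N + 3) le_rfl (by omega) (Nat.le_succ (N + 2)) s

/-! ## Level-wise (1_K) from Hu's lifting criterion and (L2) -/

/-- **Level-wise lifting from Hu's lifting criterion + the torsion lattice lemma (L2).** For `k`
perfect of characteristic `p` and `𝒳/W(k)` a smooth proper model of relative dimension `d` with
`d + 6 ≤ p`, X. Hu's Hodge obstruction maps
`ob 1 n : K₀(X_1) → ⊕_{r=1}^{d-1} ℍ^{2r}(p^{r,1}_{r,n}Ω•)` (`KTheory.HuKZeroLiftingCriterion`: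
`ker (ob 1 n) = im(K₀(X_n) → K₀(X_1))`, compatible in `n`) together with the lattice lemma (L2)
(hypothesis `hL2`: compatible families of obstruction classes killed by a non-zero integer vanish)
give: every class `y ∈ K₀(X_k)` a non-zero multiple of which lifts to every level lifts to every
level (`levelwiseLift_of_obstructionData`); in particular (clearing denominators,
`Negative.exists_int_multiple_lifts_all_levels`) the class of a finite locally free `E₁` with a
rational pro-class lift lifts to every level — verbatim the conclusion of the registered stub
`stub_levelwiseClassLift`. [folklore] -/
theorem levelwiseClassLift_of_huLiftingCriterion (hHu : HuKZeroLiftingCriterion)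
    {p : ℕ} [Fact p.Prime] {k : Type} [Field k] [CharP k p] [PerfectRing k p] {d : ℕ}
    (𝒳 : SchemeOver (WittVector p k)) (h𝒳 : IsSmoothProperModel d 𝒳) (hp : d + 6 ≤ p)
    (hL2 : ∀ (L : ℤ), L ≠ 0 → ∀ o : (∀ N : ℕ, HuObstructionTarget p k 𝒳 d 1 (N + 2)),
      (∀ N, HuObstructionTarget.reduce d 1 (Nat.le_succ (N + 2)) (o (N + 1)) = o N) →
      (∀ N, L • o N = 0) → ∀ N, o N = 0)
    (E₁ : (specialFibre 𝒳).left.Modules) (hE₁ : IsFiniteLocallyFree E₁)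
    (hξ : ∃ ξ : ContinuousKZeroRat (Ideal.span {(p : WittVector p k)}) 𝒳,
      KZeroRat.map (Crystalline.specialFibreToTower 𝒳)
        (ContinuousKZeroRat.specialFibre (Ideal.span {(p : WittVector p k)}) 𝒳 ξ) =
        KZeroRat.of E₁ hE₁) :
    ∀ n : ℕ, ∃ z : KZero (thickening 𝒳 (n + 1)).left,
      KZero.map (specialFibreToThickening 𝒳 n) z = KZero.of E₁ hE₁ := by
  obtain ⟨ob, hoba, hobb⟩ := hHu p k d 𝒳 h𝒳 hp
  refine levelwiseLift_of_obstructionData p k 𝒳 (fun N => HuObstructionTarget p k 𝒳 d 1 (N + 2))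
    (fun N => ob 1 (N + 2)) (fun N => HuObstructionTarget.reduce d 1 (Nat.le_succ (N + 2)))
    (fun N x hx => ?_) (fun N z => ?_) (fun N x => ?_) hL2 (KZero.of E₁ hE₁)
    (exists_int_multiple_lifts_all_levels hE₁ hξ)
  · exact (hoba 1 (N + 2) (by omega) le_rfl x).2 hx
  · exact (hoba 1 (N + 2) (by omega) le_rfl _).1 ⟨z, rfl⟩
  · exact (hobb 1 (N + 2) (N + 3) le_rfl (by omega) (Nat.le_succ (N + 2)) x).symm

/-! ## The crux from the two named facts and the two lattice lemmas -/

/-- **`FormalLiftingFromClassLifting` from X. Hu's two named facts and the two coherent lattice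
lemmas.** Granted `KTheory.HuKZeroLiftingCriterion` and `KTheory.HuKZeroKernelPresentation`
(X. Hu, arXiv:2507.12458, Thm. 1.2 / Prop. 11.1 (i) and Cor. 10.5 (i); claims, not proved in the
tree), and the two lattice lemmas under the hypotheses of the crux — (L1) surjectivity of the
transitions of `N ↦ ⊕_{r=1}^{p-1} ℍ^{2r-1}(p^{r,1}_{r,N+2}Ω•)` and (L2) vanishing of compatible
families killed by a non-zero integer in `N ↦ ⊕_{r=1}^{d-1} ℍ^{2r}(p^{r,1}_{r,N+2}Ω•)` — the crux
P1a holds: kernel-tower surjectivity (`kernelTower_of_huKernelPresentation`) and level-wise lifts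
of `[E₁]` (`levelwiseClassLift_of_huLiftingCriterion`) give step class lifting
(`Glue.stepClassLifting_of_levelwiseLifts_of_kernelTower`), and hypothesis (⋆) climbs the tower
(`Glue.liftsFormally_of_stepClassLifting`). CONDITIONAL on the two named facts. [folklore] -/
theorem formalLiftingFromClassLifting_of_huFacts :
    HuKZeroLiftingCriterion → HuKZeroKernelPresentation →
    (∀ (p : ℕ) [Fact p.Prime] (k : Type) [Field k] [CharP k p] [PerfectRing k p] (d : ℕ)
      (𝒳 : SchemeOver (WittVector p k)),
      IsSmoothProperModel d 𝒳 → Crystalline.IsProjectiveOverRing 𝒳 → d + 6 < p →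
      (∀ (b : ℕ) (x : structureSheafCohomology 𝒳.left b), (p : ℤ) • x = 0 → x = 0) →
      (∀ (b : ℕ) (x : hodgeCohomologyOne 𝒳 b), (p : ℤ) • x = 0 → x = 0) →
      (d ≤ 3 ∨ Nonempty (cotangentSheaf 𝒳 ≅
        SheafOfModules.free (R := 𝒳.left.ringCatSheaf) (Fin d))) →
      ∀ N : ℕ, Function.Surjective
        (HuKernelSource.reduce (p := p) (k := k) (𝒳 := 𝒳) 1 (Nat.le_succ (N + 2)))) →
    (∀ (p : ℕ) [Fact p.Prime] (k : Type) [Field k] [CharP k p] [PerfectRing k p] (d : ℕ)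
      (𝒳 : SchemeOver (WittVector p k)),
      IsSmoothProperModel d 𝒳 → Crystalline.IsProjectiveOverRing 𝒳 → d + 6 < p →
      (∀ (b : ℕ) (x : structureSheafCohomology 𝒳.left b), (p : ℤ) • x = 0 → x = 0) →
      (∀ (b : ℕ) (x : hodgeCohomologyOne 𝒳 b), (p : ℤ) • x = 0 → x = 0) →
      (d ≤ 3 ∨ Nonempty (cotangentSheaf 𝒳 ≅
        SheafOfModules.free (R := 𝒳.left.ringCatSheaf) (Fin d))) →
      ∀ (L : ℤ), L ≠ 0 → ∀ o : (∀ N : ℕ, HuObstructionTarget p k 𝒳 d 1 (N + 2)),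
        (∀ N, HuObstructionTarget.reduce d 1 (Nat.le_succ (N + 2)) (o (N + 1)) = o N) →
        (∀ N, L • o N = 0) → ∀ N, o N = 0) →
    FormalLiftingFromClassLifting := by
  intro hOb hKer hL1 hL2 p _ k _ _ _ d 𝒳 h𝒳 hproj hp hO hΩ hd E₁ hE₁ hstar hξ
  exact Glue.liftsFormally_of_stepClassLifting hE₁ hstar
    (Glue.stepClassLifting_of_levelwiseLifts_of_kernelTower hE₁
      (levelwiseClassLift_of_huLiftingCriterion hOb 𝒳 h𝒳 (by omega)
        (hL2 p k d 𝒳 h𝒳 hproj hp hO hΩ hd) E₁ hE₁ hξ)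
      (kernelTower_of_huKernelPresentation hKer 𝒳 h𝒳 (by omega)
        (hL1 p k d 𝒳 h𝒳 hproj hp hO hΩ hd)))

end

end Summit.HodgeConjecture.HodgeConjecture.Theorems.FormalLiftingFromClassLifting.HuLine
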